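import Literature.Analysis.FluidPDE.FiniteFourierModeEulerPlanarPolyB
import Literature.Analysis.FluidPDE.FiniteFourierModeEulerPlanarHoriz
import Literature.Analysis.FluidPDE.FiniteFourierModeEulerEdge
import Literature.Analysis.FluidPDE.FiniteFourierModeEulerFace
import Literature.Analysis.FluidPDE.FiniteFourierModeEulerPair

/-!
# Kishimoto–Yoneda §3 (planar case), Prop. 3.1 (i): the horizontal modes lie on a circle

Support file for `FiniteFourierModeEuler` (N. Kishimoto, T. Yoneda, J. Math. Fluid Mech. 24
(2022) 74 = arXiv:2110.08039), §3 Prop. 3.1 (i) (= the 2D theorem of Elgindi–Hu–Šverák): for a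
finite-mode solution with planar support on a generic interval whose horizontal support `S_h`
spans the plane, (a) the endpoints of every side of `conv S_h` and all points of `S_h` on it have
the same length (Lemma 4.5-type non-interaction along exposed edges, applied to the horizontal
solution `u^∥`), hence the sides carry no further points; (b) there is no point of `S_h` inside
the polygon (the point of maximal Minkowski gauge would have to interact trivially with a
vertex). Consequently ALL of `S_h` lies on one circle `|n| = R`, every pair of horizontal modes is
non-interacting, and `u^∥` is independent of time (`PlanarCfg.hcoef_const`).

## References

* [KishimotoYoneda2022] N. Kishimoto, T. Yoneda, J. Math. Fluid Mech. 24 (2022) 74 =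
  arXiv:2110.08039, §3 proof of Prop. 3.1 (i), steps (a), (b), and its last paragraph.
* [Elgindi–Hu–Šverák 2017, Thm. 1.3 in the paper] the 2D case (proof reproduced in the paper).
-/

noncomputable section

open Matrix Finset Complex

namespace Literature.Analysis.FluidPDE

namespace KY

open scoped Classical

namespace PlanarCfg

variable {I : Set ℝ} {S : Finset (Fin 3 → ℝ)} {u : (Fin 3 → ℝ) → ℝ → (Fin 3 → ℂ)}
  {e : Fin 3 → ℝ} {S_h : Finset (Fin 3 → ℝ)} (P : PlanarCfg I S u e S_h)
include P

/-- The polygon configuration of a spanning horizontal support. [folklore] -/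
theorem polyCfg (hspan : ∃ a ∈ S_h, ∃ b ∈ S_h, pc e a b ≠ 0) : PolyCfg S_h e where
  he := P.he
  zero_notMem := fun h => P.sol.zero_notMem (P.sub h)
  symm := fun _ hs => P.neg_mem_h hs
  plane := fun _ hs => P.plane_h hs
  span := hspan

/-- All horizontal modes are occupied on `I`. [folklore] -/
theorem hgen_h {t : ℝ} (ht : t ∈ I) : ∀ n ∈ S_h, uh e S_h u n t ≠ 0 := by
  intro n hn
  rw [uh_of_mem hn, P.horiz_mem (P.sub hn) ht]
  exact smul_ne_zero (P.hon n hn t ht) ((cplx_eq_zero_iff _).not.2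
    (cross_normal_ne_zero P.he (P.sol.ne_zero_of_mem (P.sub hn)) (P.plane_h hn)))

/-! ### Non-interaction of horizontal modes versus lengths -/

/-- The horizontal mode in the pair frame `(k × n₁, k)`, `k = n₁ × n₂ = κ e`. [cite: KishimotoYoneda2022, §2 Lemma 2.1] -/
theorem uh_frame₁ {n₁ n₂ : Fin 3 → ℝ} (h₁ : n₁ ∈ S_h) (h₂ : n₂ ∈ S_h) (hk : n₁ ⨯₃ n₂ ≠ 0) {t : ℝ}
    (ht : t ∈ I) :
    uh e S_h u n₁ t = (hcoef e n₁ (u n₁ t) * ((e ⬝ᵥ e : ℝ) : ℂ) / ((pc e n₁ n₂ : ℝ) : ℂ))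
        • cplx ((n₁ ⨯₃ n₂) ⨯₃ n₁) + (0 : ℂ) • cplx (n₁ ⨯₃ n₂) := by
  have hκ : pc e n₁ n₂ ≠ 0 := by
    intro h0; apply hk
    rw [cross_planar P.he (P.plane_h h₁) (P.plane_h h₂), h0, zero_div, zero_smul]
  have hee : e ⬝ᵥ e ≠ 0 := real_dot_self_ne_zero P.he
  have hp : (n₁ ⨯₃ n₂) ⨯₃ n₁ = (pc e n₁ n₂ / (e ⬝ᵥ e)) • (e ⨯₃ n₁) := by
    rw [cross_planar P.he (P.plane_h h₁) (P.plane_h h₂), map_smul, LinearMap.smul_apply]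
  rw [zero_smul, add_zero, uh_of_mem h₁, P.horiz_mem (P.sub h₁) ht, hp, cplx_smul, smul_smul]
  congr 1
  have hee' : ((e ⬝ᵥ e : ℝ) : ℂ) ≠ 0 := by exact_mod_cast hee
  have hκ' : ((pc e n₁ n₂ : ℝ) : ℂ) ≠ 0 := by exact_mod_cast hκ
  push_cast
  field_simp

/-- The second horizontal mode in the pair frame `(k × n₂, k)`. [cite: KishimotoYoneda2022, §2 Lemma 2.1] -/
theorem uh_frame₂ {n₁ n₂ : Fin 3 → ℝ} (h₁ : n₁ ∈ S_h) (h₂ : n₂ ∈ S_h) (hk : n₁ ⨯₃ n₂ ≠ 0) {t : ℝ}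
    (ht : t ∈ I) :
    uh e S_h u n₂ t = (hcoef e n₂ (u n₂ t) * ((e ⬝ᵥ e : ℝ) : ℂ) / ((pc e n₁ n₂ : ℝ) : ℂ))
        • cplx ((n₁ ⨯₃ n₂) ⨯₃ n₂) + (0 : ℂ) • cplx (n₁ ⨯₃ n₂) := by
  have hκ : pc e n₁ n₂ ≠ 0 := by
    intro h0; apply hk
    rw [cross_planar P.he (P.plane_h h₁) (P.plane_h h₂), h0, zero_div, zero_smul]
  have hee : e ⬝ᵥ e ≠ 0 := real_dot_self_ne_zero P.he
  have hp : (n₁ ⨯₃ n₂) ⨯₃ n₂ = (pc e n₁ n₂ / (e ⬝ᵥ e)) • (e ⨯₃ n₂) := by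
    rw [cross_planar P.he (P.plane_h h₁) (P.plane_h h₂), map_smul, LinearMap.smul_apply]
  rw [zero_smul, add_zero, uh_of_mem h₂, P.horiz_mem (P.sub h₂) ht, hp, cplx_smul, smul_smul]
  congr 1
  have hee' : ((e ⬝ᵥ e : ℝ) : ℂ) ≠ 0 := by exact_mod_cast hee
  have hκ' : ((pc e n₁ n₂ : ℝ) : ℂ) ≠ 0 := by exact_mod_cast hκ
  push_cast
  field_simp

/-- **Horizontal modes of equal length do not interact.** [cite: KishimotoYoneda2022, §2 Lemma 2.1 ("any pair of frequencies in `S_∥` is of the same distance from the origin, and hence has no contribution")] -/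
theorem nonInteracting_of_norm_eq {n₁ n₂ : Fin 3 → ℝ} (h₁ : n₁ ∈ S_h) (h₂ : n₂ ∈ S_h)
    (hnorm : n₁ ⬝ᵥ n₁ = n₂ ⬝ᵥ n₂) {t : ℝ} (ht : t ∈ I) :
    NonInteracting n₁ n₂ (uh e S_h u n₁ t) (uh e S_h u n₂ t) := by
  have hS_h := P.planarHoriz
  by_cases hk : n₁ ⨯₃ n₂ = 0
  · exact nonInteracting_of_cross_eq_zero (hS_h.ne_zero_of_mem h₁) (hS_h.ne_zero_of_mem h₂) hk
      (hS_h.div_free n₁ h₁ t ht) (hS_h.div_free n₂ h₂ t ht)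
  · rw [nonInteracting_frame_iff hk (P.uh_frame₁ h₁ h₂ hk ht) (P.uh_frame₂ h₁ h₂ hk ht)]
    refine ⟨?_, by ring⟩
    rw [hnorm, sub_self]; simp

/-- **Interacting-or-equal-length dichotomy**: two independent horizontal modes which do not
interact have equal lengths. [cite: KishimotoYoneda2022, §2 Prop. 2.2 (ii)' ("`|n₁| = |n₂|`")] -/
theorem norm_eq_of_nonInteracting {n₁ n₂ : Fin 3 → ℝ} (h₁ : n₁ ∈ S_h) (h₂ : n₂ ∈ S_h)
    (hk : n₁ ⨯₃ n₂ ≠ 0) {t : ℝ} (ht : t ∈ I)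
    (hNI : NonInteracting n₁ n₂ (uh e S_h u n₁ t) (uh e S_h u n₂ t)) : n₁ ⬝ᵥ n₁ = n₂ ⬝ᵥ n₂ := by
  rw [nonInteracting_frame_iff hk (P.uh_frame₁ h₁ h₂ hk ht) (P.uh_frame₂ h₁ h₂ hk ht)] at hNI
  obtain ⟨h, -⟩ := hNI
  have hκ : pc e n₁ n₂ ≠ 0 := by
    intro h0; apply hk
    rw [cross_planar P.he (P.plane_h h₁) (P.plane_h h₂), h0, zero_div, zero_smul]
  have hee : e ⬝ᵥ e ≠ 0 := real_dot_self_ne_zero P.he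
  have hα₁ := P.hon n₁ h₁ t ht
  have hα₂ := P.hon n₂ h₂ t ht
  have hc₁ : hcoef e n₁ (u n₁ t) * ((e ⬝ᵥ e : ℝ) : ℂ) / ((pc e n₁ n₂ : ℝ) : ℂ) ≠ 0 :=
    div_ne_zero (mul_ne_zero hα₁ (by exact_mod_cast hee)) (by exact_mod_cast hκ)
  have hc₂ : hcoef e n₂ (u n₂ t) * ((e ⬝ᵥ e : ℝ) : ℂ) / ((pc e n₁ n₂ : ℝ) : ℂ) ≠ 0 :=
    div_ne_zero (mul_ne_zero hα₂ (by exact_mod_cast hee)) (by exact_mod_cast hκ)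
  have := (mul_eq_zero.1 h).resolve_left (mul_ne_zero hc₁ hc₂)
  have := sub_eq_zero.1 (by exact_mod_cast this : (n₁ ⬝ᵥ n₁ : ℝ) - n₂ ⬝ᵥ n₂ = 0)
  exact this

/-! ### (a) The sides of the polygon -/

section Sides

variable (hspan : ∃ a ∈ S_h, ∃ b ∈ S_h, pc e a b ≠ 0)

/-- Shorthand for the polygon configuration. -/
local notation "Q" => PlanarCfg.polyCfg P hspan

/-- **Points of `S_h` on a side have the length of its first endpoint** (Lemma 4.5-type
non-interaction along the exposed edge, for `u^∥`). [cite: KishimotoYoneda2022, §3 proof of Prop. 3.1 (i)(a) ("`|n₁| = |n₂|`")] -/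
theorem norm_eq_on_side (j : ℕ) {s : Fin 3 → ℝ} (hs : s ∈ S_h) (h1 : (Q).fE j s = 1) :
    s ⬝ᵥ s = (Q).V j ⬝ᵥ (Q).V j := by
  obtain ⟨t, ht⟩ := P.sol.nonempty
  obtain ⟨θ, hθ0, -, hθ⟩ := (Q).fE_eq_one j hs h1
  rcases hθ0.lt_or_eq with hθpos | hθz
  · set d := (Q).V (j + 1) - (Q).V j with hd
    set ψ : Fin 3 → ℝ := (pc e ((Q).V j) ((Q).V (j + 1)))⁻¹ • (((Q).V (j + 1) - (Q).V j) ⨯₃ e) with hψ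
    have hψf : ∀ x, ψ ⬝ᵥ x = (Q).fE j x := fun x => by rw [hψ, ← (Q).fE_eq_dot]
    have hk : (Q).V j ⨯₃ d ≠ 0 := by
      rw [hd, map_sub, cross_self, sub_zero]
      intro h0
      have := (Q).tau_pos j
      unfold pc at this; rw [h0, dotProduct_zero] at this; exact lt_irrefl _ this
    have hNI := P.planarHoriz.nonInteracting_endpoint_of_exposed_ray ht (P.hgen_h ht)
      (ψ := ψ) (n₁ := (Q).V j) (e := d) ((Q).V_mem j) (by rw [hψf, (Q).fE_V_self]; exact one_pos)
      (fun x hx => by rw [hψf, hψf, (Q).fE_V_self]; exact (Q).fE_le_one j hx)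
      (fun x hx heq => by
        rw [hψf, hψf, (Q).fE_V_self] at heq
        obtain ⟨θ', hθ'0, -, hθ'⟩ := (Q).fE_eq_one j hx heq
        exact ⟨θ', hθ'0, hθ'⟩)
      (by rw [hψf, hd, (Q).fE_sub, (Q).fE_V_succ, (Q).fE_V_self, sub_self]) hk hθpos
      (by rw [← hθ]; exact hs)
    rw [← hθ] at hNI
    have hk' : (Q).V j ⨯₃ s ≠ 0 := by
      rw [hθ, map_add, map_smul, cross_self, zero_add]; exact smul_ne_zero hθpos.ne' hk
    exact (P.norm_eq_of_nonInteracting ((Q).V_mem j) hs hk' ht hNI).symm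
  · rw [hθ, ← hθz, zero_smul, add_zero]

/-- **All vertices have the same length `R = |V₀|`.** [cite: KishimotoYoneda2022, §3 proof of Prop. 3.1 (i)(a)] -/
theorem norm_V (j : ℕ) : (Q).V j ⬝ᵥ (Q).V j = (Q).V 0 ⬝ᵥ (Q).V 0 := by
  induction j with
  | zero => rfl
  | succ j ih => rw [← ih]; exact P.norm_eq_on_side hspan j ((Q).V_mem (j + 1)) ((Q).fE_V_succ j)

omit P in
/-- **The chord lemma**: a point of a segment whose endpoints and itself have the same length is
an endpoint. [folklore] -/
theorem chord {a b : Fin 3 → ℝ} {θ : ℝ} (hab : a ≠ b) (hθ0 : 0 ≤ θ) (hθ1 : θ ≤ 1)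
    (hb : b ⬝ᵥ b = a ⬝ᵥ a) (hs : (a + θ • (b - a)) ⬝ᵥ (a + θ • (b - a)) = a ⬝ᵥ a) : θ = 0 ∨ θ = 1 := by
  have hd : (b - a) ⬝ᵥ (b - a) ≠ 0 := fun h => hab (sub_eq_zero.1 (dotProduct_self_eq_zero.1 h)).symm
  have h1 : 2 * (a ⬝ᵥ (b - a)) = -((b - a) ⬝ᵥ (b - a)) := by
    have : b = a + (b - a) := by abel
    have hb' := hb
    rw [this] at hb'
    simp only [add_dotProduct, dotProduct_add, dotProduct_comm (b - a) a] at hb'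
    linarith
  simp only [add_dotProduct, dotProduct_add, dotProduct_smul, smul_dotProduct, smul_eq_mul,
    dotProduct_comm (b - a) a] at hs
  have : θ * (θ - 1) * ((b - a) ⬝ᵥ (b - a)) = 0 := by nlinarith
  rcases mul_eq_zero.1 this with h | h
  · rcases mul_eq_zero.1 h with h | h
    · exact Or.inl h
    · exact Or.inr (by linarith)
  · exact absurd h hd

/-- **The sides carry no further points of `S_h`**: `f_j(s) = 1`, `s ∈ S_h` forces
`s ∈ {V_j, V_{j+1}}`. [cite: KishimotoYoneda2022, §3 proof of Prop. 3.1 (i)(a) ("`p = 2`")] -/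
theorem eq_V_of_fE_eq_one (j : ℕ) {s : Fin 3 → ℝ} (hs : s ∈ S_h) (h1 : (Q).fE j s = 1) :
    s = (Q).V j ∨ s = (Q).V (j + 1) := by
  obtain ⟨θ, hθ0, hθ1, hθ⟩ := (Q).fE_eq_one j hs h1
  have hns := P.norm_eq_on_side hspan j hs h1
  rw [hθ] at hns
  rcases chord ((Q).V_ne_succ j) hθ0 hθ1
      (by rw [P.norm_V hspan (j + 1), P.norm_V hspan j]) hns with h | h
  · left; rw [hθ, h, zero_smul, add_zero]
  · right; rw [hθ, h, one_smul, add_sub_cancel]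

end Sides

end PlanarCfg

/-! ### Step (b): no horizontal modes inside the polygon

A point `n₀ ∈ S_∥` inside the polygon of maximal gauge `N(n₀) < 1`, `n₀ = N(n₀)[(1-θ)n₁ + θ n₂]`,
would have to interact trivially with the vertex `n₂` (all other pairs with the same sum consist of
two vertices, which do not interact), forcing `|n₀| = |n₂|` — a contradiction. Hence all of `S_h`
lies on the circle `|n| = R`, all pairs of horizontal modes are non-interacting, and `u^∥` is
independent of time. -/

namespace PlanarCfg

variable {I : Set ℝ} {S : Finset (Fin 3 → ℝ)} {u : (Fin 3 → ℝ) → ℝ → (Fin 3 → ℂ)}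
  {e : Fin 3 → ℝ} {S_h : Finset (Fin 3 → ℝ)} (P : PlanarCfg I S u e S_h)
  (hspan : ∃ a ∈ S_h, ∃ b ∈ S_h, pc e a b ≠ 0)
include P hspan

/-- Shorthand for the polygon configuration. -/
local notation "Q" => PlanarCfg.polyCfg P hspan

/-- Every horizontal mode has length at most `R = |V₀|`. [folklore] -/
theorem norm_le_R {s : Fin 3 → ℝ} (hs : s ∈ S_h) : s ⬝ᵥ s ≤ (Q).V 0 ⬝ᵥ (Q).V 0 := by
  rw [(Q).V_zero]; exact (Q).far_max s hs

/-- **The "simple geometric observation"**: for `b₀ = s V_j + t V_{j+1}` with `s < 1`, the point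
`b₀ + (V_{j+1} - V_j)` has gauge `> s + t`. [cite: KishimotoYoneda2022, §3 proof of Prop. 3.1 (i)(b)] -/
theorem fE_succ_shift_gt (j : ℕ) {s t : ℝ} (hs1 : s < 1) :
    s + t < (Q).fE (j + 1) (s • (Q).V j + t • (Q).V (j + 1) + ((Q).V (j + 1) - (Q).V j)) := by
  have hg : (Q).fE (j + 1) ((Q).V j) < 1 :=
    (Q).fE_lt_one_of_V ((Q).V_ne_succ j) ((Q).V_ne_add_two j)
  rw [(Q).fE_add, (Q).fE_combo, (Q).fE_sub, (Q).fE_V_self, ]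
  nlinarith

/-- **Prop. 3.1 (i): all horizontal modes lie on the circle `|n| = R`.**
[cite: KishimotoYoneda2022, §3 Prop. 3.1 (i) ("`S_∥` … is a subset of a circle centered at the origin")] -/
theorem norm_eq_R : ∀ s ∈ S_h, s ⬝ᵥ s = (Q).V 0 ⬝ᵥ (Q).V 0 := by
  set R2 := (Q).V 0 ⬝ᵥ (Q).V 0 with hR2
  by_contra hno
  push Not at hno
  set B := S_h.filter fun s => s ⬝ᵥ s ≠ R2 with hB
  have hBne : B.Nonempty := by
    obtain ⟨s, hs, hne⟩ := hno; exact ⟨s, Finset.mem_filter.2 ⟨hs, hne⟩⟩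
  obtain ⟨b₀, hb₀B, hb₀max⟩ := B.exists_max_image (fun s => (Q).Nf s) hBne
  obtain ⟨hb₀, hb₀R⟩ := Finset.mem_filter.1 hb₀B
  have hmaxB : ∀ b ∈ S_h, b ⬝ᵥ b ≠ R2 → (Q).Nf b ≤ (Q).Nf b₀ := fun b hb hbR =>
    hb₀max b (Finset.mem_filter.2 ⟨hb, hbR⟩)
  have hgood : ∀ b ∈ S_h, (Q).Nf b₀ < (Q).Nf b → b ⬝ᵥ b = R2 := by
    intro b hb hlt; by_contra hne; exact absurd (hmaxB b hb hne) (not_le.2 hlt)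
  -- the sector of `b₀`
  have hb₀0 : b₀ ≠ 0 := fun h => P.sol.zero_notMem (P.sub (h ▸ hb₀))
  obtain ⟨j, -, s, t, hs, ht, hb₀e⟩ := (Q).exists_sector (P.plane_h hb₀) hb₀0
  set N₀ := (Q).Nf b₀ with hN₀
  have hN₀st : N₀ = s + t := by rw [hN₀, hb₀e, (Q).Nf_sector j hs.le ht]
  have hVR : ∀ i, (Q).V i ⬝ᵥ (Q).V i = R2 := fun i => P.norm_V hspan i
  have hN₀1 : N₀ < 1 := by
    rcases ((Q).Nf_le_one hb₀).lt_or_eq with h | h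
    · exact h
    · exfalso
      have h1 : (Q).fE j b₀ = 1 := by rw [hb₀e, (Q).fE_sector_self]; rw [← hN₀, hN₀st] at h; exact h
      rcases P.eq_V_of_fE_eq_one hspan j hb₀ h1 with h' | h' <;> exact hb₀R (by rw [h']; exact hVR _)
  have hs1 : s < 1 := by linarith
  -- the partner vertex and the sum
  have hvS : (Q).V (j + 1) ∈ S_h := (Q).V_mem (j + 1)
  have hsum : b₀ + (Q).V (j + 1) ∉ S_h := by
    intro hmem
    have := (Q).fE_le_one j hmem
    rw [(Q).fE_add, hb₀e, (Q).fE_sector_self, (Q).fE_V_succ] at this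
    linarith
  have hb₀v : b₀ ≠ (Q).V (j + 1) := fun h => hb₀R (by rw [h]; exact hVR _)
  -- classification of the other pairs
  have hL : ∀ c ∈ S_h, ∀ d ∈ S_h, c + d = b₀ + (Q).V (j + 1) → ¬ (c = b₀ ∧ d = (Q).V (j + 1)) → c ⬝ᵥ c = R2 := by
    intro c hc d hd hcd hne
    have hfsum : (Q).fE j c + (Q).fE j d = N₀ + 1 := by
      rw [← (Q).fE_add, hcd, (Q).fE_add, hb₀e, (Q).fE_sector_self, (Q).fE_V_succ, hN₀st]
    have hfc := (Q).fE_le_one j hc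
    have hfd := (Q).fE_le_one j hd
    rcases hfc.lt_or_eq with hclt | hceq
    · -- `f_j c < 1`
      rcases (show N₀ ≤ (Q).fE j c by linarith).lt_or_eq with hlt | heq
      · exact hgood c hc (lt_of_lt_of_le hlt ((Q).fE_le_Nf j c))
      · -- `f_j c = N₀`, so `f_j d = 1`: `d ∈ {V_j, V_{j+1}}`
        have hd1 : (Q).fE j d = 1 := by linarith
        rcases P.eq_V_of_fE_eq_one hspan j hd hd1 with hdj | hdv
        · -- `d = V_j`, `c = b₀ + (V_{j+1} - V_j)`: the geometric observation
          have hc' : c = s • (Q).V j + t • (Q).V (j + 1) + ((Q).V (j + 1) - (Q).V j) := by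
            have := hcd; rw [hdj] at this
            rw [← hb₀e, eq_sub_of_add_eq this]; abel
          apply hgood c hc
          calc N₀ = s + t := hN₀st
            _ < (Q).fE (j + 1) c := by rw [hc']; exact P.fE_succ_shift_gt hspan j hs1
            _ ≤ (Q).Nf c := (Q).fE_le_Nf _ _
        · exfalso; apply hne
          refine ⟨?_, hdv⟩
          have := hcd; rw [hdv] at this; exact add_right_cancel this
    · rcases P.eq_V_of_fE_eq_one hspan j hc hceq with h | h <;> rw [h] <;> exact hVR _
  obtain ⟨t₀, ht₀⟩ := P.sol.nonempty
  have hNI := P.planarHoriz.nonInteracting_of_others_vanish hb₀ hvS hb₀v hsum ht₀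
    (fun c hc d hd hcd' hcd h1 h2 => P.nonInteracting_of_norm_eq hc hd
      (by rw [hL c hc d hd hcd h1, hL d hd c hc (by rw [add_comm]; exact hcd) (fun h => h2 ⟨h.2, h.1⟩)]) ht₀)
  -- `b₀` and `(Q).V (j + 1)` are independent
  have hk : b₀ ⨯₃ (Q).V (j + 1) ≠ 0 := by
    intro h0
    have : pc e b₀ ((Q).V (j + 1)) = 0 := by unfold pc; rw [h0, dotProduct_zero]
    rw [hb₀e, pc_add_left, pc_smul_left, pc_smul_left, pc_self, mul_zero, add_zero] at this
    exact (mul_ne_zero hs.ne' ((Q).tau_pos j).ne') this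
  have := P.norm_eq_of_nonInteracting hb₀ hvS hk ht₀ hNI
  exact hb₀R (by rw [this]; exact hVR _)

/-- **All pairs of horizontal modes are non-interacting.** [cite: KishimotoYoneda2022, §3 proof of Prop. 3.1 (i), last paragraph] -/
theorem nonInteracting_h {a b : Fin 3 → ℝ} (ha : a ∈ S_h) (hb : b ∈ S_h) {t : ℝ} (ht : t ∈ I) :
    NonInteracting a b (uh e S_h u a t) (uh e S_h u b t) :=
  P.nonInteracting_of_norm_eq ha hb (by rw [P.norm_eq_R hspan a ha, P.norm_eq_R hspan b hb]) ht

/-- **`u^∥` is independent of time.** [cite: KishimotoYoneda2022, §3 Prop. 3.1 (i) ("`∂_t u^∥ = 0`")] -/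
theorem uh_const (n : Fin 3 → ℝ) {t s : ℝ} (ht : t ∈ I) (hs : s ∈ I) :
    uh e S_h u n t = uh e S_h u n s :=
  P.planarHoriz.stationary_of_nonInteracting
    (fun _ ht _ ha _ hb _ _ => P.nonInteracting_h hspan ha hb ht) n ht hs

/-- **The horizontal coefficients `α_n` are independent of time.** [cite: KishimotoYoneda2022, §3 Prop. 3.1 (i)] -/
theorem hcoef_const (n : Fin 3 → ℝ) {t s : ℝ} (ht : t ∈ I) (hs : s ∈ I) :
    hcoef e n (u n t) = hcoef e n (u n s) := by
  by_cases hn : n ∈ S_h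
  · have h := P.uh_const hspan n ht hs
    rw [uh_of_mem hn, uh_of_mem hn, P.horiz_mem (P.sub hn) ht, P.horiz_mem (P.sub hn) hs] at h
    have hk : cplx (e ⨯₃ n) ≠ 0 := (cplx_eq_zero_iff _).not.2
      (cross_normal_ne_zero P.he (P.sol.ne_zero_of_mem (P.sub hn)) (P.plane_h hn))
    exact smul_left_injective ℂ hk h
  · by_cases hnS : n ∈ S
    · rw [P.hoff n hnS hn t ht, P.hoff n hnS hn s hs]
    · rw [P.sol.eq_zero_of_notMem n hnS t, P.sol.eq_zero_of_notMem n hnS s]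

end PlanarCfg

end KY

end Literature.Analysis.FluidPDE
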